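import Literature.MathematicalPhysics.QuantumManyBody.TorusFockSectorDictionary
import Mathlib.Analysis.Calculus.LineDeriv.IntegrationByParts
import HarnessLib

/-!
# Fourier coefficients of compactly supported functions on the cell: derivative rule and `L²` tails

Topic `Literature/MathematicalPhysics/QuantumManyBody`, namespace `BoseGas`; theorem-only, for the
provefact `Literature.MathematicalPhysics.QuantumManyBody.BoseGas.BastiCenatiempoSchlein2021_upperBound`
(the band-limited comparison function for the Galerkin scattering energy, Lemma 2.1 (ii) of
[BastiCenatiempoSchlein2021]: `ĝ₀ ≤ 8π𝔞(1 + Cρ^{3/5})`).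

For a `C¹` function `φ` on `ℝ³` whose support lies in the cell `[0,L)³`:

* `cellFourierCoeff_fderiv_of_support` — `ĉₙ(∂ⱼφ) = (2πi nⱼ/L) ĉₙ(φ)` (integration by parts on `ℝ³`,
  no boundary terms since `φ` vanishes outside the cell);
* `tsum_sq_grad_cellFourierCoeff_of_support` — Parseval for the gradient,
  `∑ₙ (4π²|n|²/L²)‖ĉₙ‖₊² = L⁻³∫_cell ∑ⱼ‖∂ⱼφ‖₊²`;
* `integral_cell_sq_sub_trigPoly` — for continuous `φ` and a finite set of modes `B`,
  `∫_cell ‖φ - ∑_{n∈B} ĉₙ eₙ‖² = L³(∑ₙ‖ĉₙ‖² - ∑_{n∈B}‖ĉₙ‖²)` (the `L²` tail of the sharp projection);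
* `norm_trigPoly_le` — `‖∑_{n∈B} ĉₙ eₙ(x)‖ ≤ ∑_{n∈B}‖ĉₙ‖`.

## References

* [BastiCenatiempoSchlein2021] G. Basti, S. Cenatiempo, B. Schlein, Forum Math. Sigma 9 (2021) e74,
  arXiv:2101.06222: Lemma 2.1 (ii).
-/

noncomputable section

open MeasureTheory Filter Set WithLp Complex
open scoped ENNReal NNReal Topology ComplexConjugate BigOperators

namespace Literature.MathematicalPhysics.QuantumManyBody.BoseGas

variable {L : ℝ}

/-! ### Integration by parts for functions supported in the cell -/

/-- A function supported in the cell has cell integral equal to its integral. [folklore] -/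
theorem setIntegral_cell_eq_integral_of_support {ψ : Space → ℂ} (hsupp : Function.support ψ ⊆ cell L) :
    ∫ x in cell L, ψ x = ∫ x, ψ x := by
  rw [← integral_indicator (measurableSet_cell L)]
  refine integral_congr_ae (Eventually.of_forall fun x => ?_)
  by_cases hx : x ∈ cell L
  · rw [indicator_of_mem hx]
  · rw [indicator_of_notMem hx]
    exact (Function.notMem_support.1 fun h => hx (hsupp h)).symm

/-- **`∫ ∂ⱼψ = 0`** for a compactly supported `C¹` function on `ℝ³`. [folklore] -/
theorem integral_fderiv_eq_zero_of_hasCompactSupport {ψ : Space → ℂ} (hψ : ContDiff ℝ 1 ψ)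
    (hcs : HasCompactSupport ψ) (j : Fin 3) :
    ∫ x, fderiv ℝ ψ x (EuclideanSpace.single j 1) = 0 := by
  have hdiff : Differentiable ℝ ψ := hψ.differentiable one_ne_zero
  have hcont' : Continuous fun x => fderiv ℝ ψ x (EuclideanSpace.single j (1 : ℝ)) :=
    (hψ.continuous_fderiv one_ne_zero).clm_apply continuous_const
  have hcs' : HasCompactSupport fun x => fderiv ℝ ψ x (EuclideanSpace.single j (1 : ℝ)) :=
    (hcs.fderiv_apply (𝕜 := ℝ) (EuclideanSpace.single j (1 : ℝ)))
  have h := integral_mul_fderiv_eq_neg_fderiv_mul_of_integrable (μ := (volume : Measure Space))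
    (f := fun _ : Space => (1 : ℂ)) (g := ψ) (v := EuclideanSpace.single j (1 : ℝ))
    (by
      have : (fun x : Space => fderiv ℝ (fun _ : Space => (1 : ℂ)) x (EuclideanSpace.single j (1 : ℝ)) * ψ x) = fun _ => 0 := by
        funext x; simp
      rw [this]; exact integrable_zero _ _ _)
    (by simpa using hcont'.integrable_of_hasCompactSupport hcs')
    (by simpa using hψ.continuous.integrable_of_hasCompactSupport hcs)
    (fun x _ => differentiableAt_const _) (fun x _ => hdiff x)
  simpa using h

/-- **The derivative rule `ĉₙ(∂ⱼφ) = (2πi nⱼ/L) ĉₙ(φ)`** for a `C¹` function with (topological)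
support in the cell. [folklore] -/
theorem cellFourierCoeff_fderiv_of_support (hL : 0 < L) {φ : Space → ℂ} (hφ : ContDiff ℝ 1 φ)
    (hcs : HasCompactSupport φ) (hsupp : tsupport φ ⊆ cell L) (j : Fin 3) (n : Fin 3 → ℤ) :
    cellFourierCoeff L (fun x => fderiv ℝ φ x (EuclideanSpace.single j 1)) n =
      (2 * Real.pi * Complex.I * (n j) / L) * cellFourierCoeff L φ n := by
  have hdiff : Differentiable ℝ φ := hφ.differentiable one_ne_zero
  -- integration by parts applied to `ψ = e_{-n} φ` on `ℝ³`
  set ψ : Space → ℂ := fun x => cellWave L (-n) x * φ x with hψdef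
  have hψC : ContDiff ℝ 1 ψ := ((contDiff_cellWave L (-n)).of_le (mod_cast le_top)).mul hφ
  have hψcs : HasCompactSupport ψ := hcs.mul_left
  have hIBP := integral_fderiv_eq_zero_of_hasCompactSupport hψC hψcs j
  -- product rule
  have hprod : ∀ x : Space, fderiv ℝ ψ x (EuclideanSpace.single j 1) =
      cellWave L (-n) x * fderiv ℝ φ x (EuclideanSpace.single j 1) +
        (2 * Real.pi * Complex.I * ((-n) j) / L) * cellWave L (-n) x * φ x := by
    intro x
    have hw : DifferentiableAt ℝ (cellWave L (-n)) x :=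
      ((contDiff_cellWave L (-n)).differentiable (by simp)) x
    have h := hw.hasFDerivAt.mul (hdiff x).hasFDerivAt
    rw [show ψ = (cellWave L (-n)) * φ from rfl, h.fderiv, add_apply,
      smul_apply, smul_apply, fderiv_cellWave_apply_single,
      smul_eq_mul, smul_eq_mul]
    ring
  simp only [hprod] at hIBP
  -- supports inside the cell: cell integrals are integrals
  have hsφ : Function.support φ ⊆ cell L := (subset_tsupport φ).trans hsupp
  have hsdφ : Function.support (fun x => fderiv ℝ φ x (EuclideanSpace.single j (1 : ℝ))) ⊆ cell L := by
    intro x hx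
    refine hsupp (support_fderiv_subset ℝ ?_)
    rw [Function.mem_support] at hx ⊢
    exact fun h => hx (by rw [h]; rfl)
  have hs1 : Function.support (fun x => cellWave L (-n) x * fderiv ℝ φ x (EuclideanSpace.single j 1)) ⊆ cell L :=
    (Function.support_mul_subset_right _ _).trans hsdφ
  have hs2 : Function.support (fun x => cellWave L (-n) x * φ x) ⊆ cell L :=
    (Function.support_mul_subset_right _ _).trans hsφ
  -- integrability on `ℝ³`
  have hcont' : Continuous fun x => fderiv ℝ φ x (EuclideanSpace.single j (1 : ℝ)) :=
    (hφ.continuous_fderiv one_ne_zero).clm_apply continuous_const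
  have hi1 : Integrable (fun x => cellWave L (-n) x * fderiv ℝ φ x (EuclideanSpace.single j 1)) :=
    ((contDiff_cellWave L (-n)).continuous.mul hcont').integrable_of_hasCompactSupport
      ((hcs.fderiv_apply (𝕜 := ℝ) (EuclideanSpace.single j (1 : ℝ))).mul_left)
  have hi2 : Integrable (fun x => (2 * Real.pi * Complex.I * ((-n) j) / L) * cellWave L (-n) x * φ x) := by
    have h0 : Integrable (fun x => cellWave L (-n) x * φ x) (volume : Measure Space) :=
      ((contDiff_cellWave L (-n)).continuous.mul hφ.continuous).integrable_of_hasCompactSupport hcs.mul_left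
    have := h0.const_mul (2 * Real.pi * Complex.I * ((-n) j) / L)
    refine this.congr (Eventually.of_forall fun x => ?_)
    ring
  rw [integral_add hi1 hi2] at hIBP
  have hi2' : ∫ x, (2 * Real.pi * Complex.I * ((-n) j) / L) * cellWave L (-n) x * φ x =
      (2 * Real.pi * Complex.I * ((-n) j) / L) * ∫ x, cellWave L (-n) x * φ x := by
    rw [← integral_const_mul]
    congr 1; funext x; ring
  rw [hi2'] at hIBP
  rw [cellFourierCoeff_eq_integral hL, cellFourierCoeff_eq_integral hL]
  simp only [conj_cellWave]
  rw [setIntegral_cell_eq_integral_of_support hs1, setIntegral_cell_eq_integral_of_support hs2,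
    Complex.real_smul, Complex.real_smul]
  have key : ∫ x, cellWave L (-n) x * fderiv ℝ φ x (EuclideanSpace.single j 1) =
      (2 * Real.pi * Complex.I * (n j) / L) * ∫ x, cellWave L (-n) x * φ x := by
    have h := eq_neg_of_add_eq_zero_left hIBP
    rw [h]
    simp only [Pi.neg_apply, Int.cast_neg]
    ring
  rw [key]
  ring

/-- `‖ĉₙ(∂ⱼφ)‖₊² = (4π² nⱼ²/L²) ‖ĉₙ(φ)‖₊²` for `φ` supported in the cell. [folklore] -/
theorem nnnorm_sq_cellFourierCoeff_fderiv_of_support (hL : 0 < L) {φ : Space → ℂ}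
    (hφ : ContDiff ℝ 1 φ) (hcs : HasCompactSupport φ) (hsupp : tsupport φ ⊆ cell L)
    (j : Fin 3) (n : Fin 3 → ℤ) :
    ((‖cellFourierCoeff L (fun x => fderiv ℝ φ x (EuclideanSpace.single j 1)) n‖₊ : ℝ≥0∞) ^ 2) =
      ENNReal.ofReal (4 * Real.pi ^ 2 * (n j : ℝ) ^ 2 / L ^ 2) *
        (‖cellFourierCoeff L φ n‖₊ : ℝ≥0∞) ^ 2 := by
  rw [cellFourierCoeff_fderiv_of_support hL hφ hcs hsupp, coe_nnnorm_sq_eq_ofReal, coe_nnnorm_sq_eq_ofReal,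
    ← ENNReal.ofReal_mul (by positivity), norm_mul, mul_pow]
  congr 1
  have h : ‖(2 * Real.pi * Complex.I * (n j) / L : ℂ)‖ = 2 * Real.pi * |(n j : ℝ)| / L := by
    rw [show (2 * Real.pi * Complex.I * (n j) / L : ℂ) = ((2 * Real.pi * (n j : ℝ) / L : ℝ) : ℂ) * Complex.I by
      push_cast; ring]
    rw [norm_mul, Complex.norm_I, mul_one, Complex.norm_real, Real.norm_eq_abs, abs_div, abs_mul,
      abs_of_pos (by positivity : (0 : ℝ) < 2 * Real.pi), abs_of_pos hL]
  rw [h]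
  field_simp
  rw [sq_abs]
  ring

/-- **Parseval for the gradient** of a `C¹` function supported in the cell:
`∑ₙ (4π²|n|²/L²) ‖ĉₙ(φ)‖₊² = L⁻³ ∫⁻_cell ∑ⱼ ‖∂ⱼφ‖₊²`. [folklore] -/
theorem tsum_sq_grad_cellFourierCoeff_of_support (hL : 0 < L) {φ : Space → ℂ} (hφ : ContDiff ℝ 1 φ)
    (hcs : HasCompactSupport φ) (hsupp : tsupport φ ⊆ cell L) :
    ∑' n : Fin 3 → ℤ, ENNReal.ofReal (4 * Real.pi ^ 2 * (∑ j, (n j : ℝ) ^ 2) / L ^ 2) *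
        (‖cellFourierCoeff L φ n‖₊ : ℝ≥0∞) ^ 2 =
      (ENNReal.ofReal L ^ 3)⁻¹ * ∫⁻ x in cell L,
        ∑ j : Fin 3, (‖fderiv ℝ φ x (EuclideanSpace.single j (1 : ℝ))‖₊ : ℝ≥0∞) ^ 2 := by
  have hcont : ∀ j : Fin 3, Continuous fun x => fderiv ℝ φ x (EuclideanSpace.single j (1 : ℝ)) :=
    fun j => (hφ.continuous_fderiv one_ne_zero).clm_apply continuous_const
  have hsplit : ∀ n : Fin 3 → ℤ, ENNReal.ofReal (4 * Real.pi ^ 2 * (∑ j, (n j : ℝ) ^ 2) / L ^ 2) *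
      (‖cellFourierCoeff L φ n‖₊ : ℝ≥0∞) ^ 2 =
      ∑ j : Fin 3, ((‖cellFourierCoeff L (fun x => fderiv ℝ φ x (EuclideanSpace.single j 1)) n‖₊ :
        ℝ≥0∞) ^ 2) := by
    intro n
    simp only [nnnorm_sq_cellFourierCoeff_fderiv_of_support hL hφ hcs hsupp]
    rw [← Finset.sum_mul, ← ENNReal.ofReal_sum_of_nonneg (fun j _ => by positivity)]
    congr 2
    rw [Finset.mul_sum, Finset.sum_div]
  simp only [hsplit]
  rw [Summable.tsum_finsetSum (fun j _ => ENNReal.summable)]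
  simp only [tsum_sq_cellFourierCoeff hL (hcont _)]
  rw [← Finset.mul_sum, lintegral_finsetSum _ (fun j _ => ?_)]
  exact ((hcont j).measurable.nnnorm.coe_nnreal_ennreal.pow_const _)

/-! ### The sharp projection: `L²` tail and a sup bound -/

/-- **`‖∑_{n∈B} ĉₙ eₙ(x)‖ ≤ ∑_{n∈B} ‖ĉₙ‖`.** [folklore] -/
theorem norm_trigPoly_le (L : ℝ) (c : (Fin 3 → ℤ) → ℂ) (B : Finset (Fin 3 → ℤ)) (x : Space) :
    ‖∑ n ∈ B, c n * cellWave L n x‖ ≤ ∑ n ∈ B, ‖c n‖ := by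
  refine (norm_sum_le _ _).trans (le_of_eq (Finset.sum_congr rfl fun n _ => ?_))
  rw [norm_mul, norm_cellWave, mul_one]

/-- **The `L²` tail of the sharp projection**: for continuous `φ` and a finite set of modes `B`,
`∫_cell ‖φ - ∑_{n∈B} ĉₙeₙ‖² = L³(∑ₙ ‖ĉₙ‖² - ∑_{n∈B} ‖ĉₙ‖²)`. [folklore] -/
theorem integral_cell_sq_sub_trigPoly (hL : 0 < L) {φ : Space → ℂ} (hφ : Continuous φ) (B : Finset (Fin 3 → ℤ)) :
    ∫ x in cell L, ‖φ x - ∑ n ∈ B, cellFourierCoeff L φ n * cellWave L n x‖ ^ 2 =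
      L ^ 3 * (∑' n, ‖cellFourierCoeff L φ n‖ ^ 2 - ∑ n ∈ B, ‖cellFourierCoeff L φ n‖ ^ 2) := by
  set c := cellFourierCoeff L φ with hc
  set P : Space → ℂ := fun x => ∑ n ∈ B, c n * cellWave L n x with hP
  have hPc : Continuous P := by
    simp only [hP]; exact continuous_finsetSum _ fun n _ => continuous_const.mul (continuous_cellWave L n)
  have hL3 : (L : ℂ) ^ 3 = ((L ^ 3 : ℝ) : ℂ) := by push_cast; ring
  -- `∫ φ conj(e_n) = L³ c_n`, `∫ e_n conj(e_m) = L³ δ`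
  have hL0 : (L : ℂ) ≠ 0 := by exact_mod_cast hL.ne'
  have hcoef : ∀ n, ∫ x in cell L, φ x * conj (cellWave L n x) = (L : ℂ) ^ 3 * c n := by
    intro n
    rw [hc, cellFourierCoeff_eq_integral hL, Complex.real_smul]
    have : ∫ x in cell L, conj (cellWave L n x) * φ x = ∫ x in cell L, φ x * conj (cellWave L n x) :=
      integral_congr_ae (Eventually.of_forall fun x => by simp only; ring)
    rw [← this, ← mul_assoc, show (L : ℂ) ^ 3 * (((L ^ 3)⁻¹ : ℝ) : ℂ) = 1 by push_cast; field_simp, one_mul]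
  have horth : ∀ n m, ∫ x in cell L, cellWave L n x * conj (cellWave L m x) = if n = m then (L : ℂ) ^ 3 else 0 := by
    intro n m
    simp only [conj_cellWave, ← cellWave_add_index]
    rw [integral_cell_cellWave hL]
    by_cases h : n = m
    · subst h; simp
    · rw [if_neg (fun h' => h (by simpa [add_neg_eq_zero] using h')), if_neg h]
  -- integrability of the pieces
  have hint : ∀ {ψ : Space → ℂ}, Continuous ψ → IntegrableOn ψ (cell L) volume := fun hψ => integrableOn_cell hψ
  -- expand the square
  have hexp : ∀ x : Space, ((‖φ x - P x‖ ^ 2 : ℝ) : ℂ) =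
      φ x * conj (φ x) - φ x * conj (P x) - P x * conj (φ x) + P x * conj (P x) := by
    intro x
    rw [Complex.ofReal_pow, ← Complex.conj_mul', map_sub]; ring
  have hmain : ((∫ x in cell L, ‖φ x - P x‖ ^ 2 : ℝ) : ℂ) =
      (L : ℂ) ^ 3 * ((∑' n, ‖c n‖ ^ 2 : ℝ) : ℂ) - (L : ℂ) ^ 3 * ∑ n ∈ B, ((‖c n‖ ^ 2 : ℝ) : ℂ) := by
    rw [← integral_complex_ofReal]
    simp only [hexp]
    have i1 : IntegrableOn (fun x => φ x * conj (φ x)) (cell L) volume := hint (hφ.mul (Complex.continuous_conj.comp hφ))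
    have i2 : IntegrableOn (fun x => φ x * conj (P x)) (cell L) volume := hint (hφ.mul (Complex.continuous_conj.comp hPc))
    have i3 : IntegrableOn (fun x => P x * conj (φ x)) (cell L) volume := hint (hPc.mul (Complex.continuous_conj.comp hφ))
    have i4 : IntegrableOn (fun x => P x * conj (P x)) (cell L) volume := hint (hPc.mul (Complex.continuous_conj.comp hPc))
    have e1 : ∫ x in cell L, (φ x * conj (φ x) - φ x * conj (P x) - P x * conj (φ x) + P x * conj (P x)) =
        (∫ x in cell L, (φ x * conj (φ x) - φ x * conj (P x) - P x * conj (φ x))) + ∫ x in cell L, P x * conj (P x) :=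
      integral_add ((i1.sub i2).sub i3) i4
    have e2 : ∫ x in cell L, (φ x * conj (φ x) - φ x * conj (P x) - P x * conj (φ x)) =
        (∫ x in cell L, (φ x * conj (φ x) - φ x * conj (P x))) - ∫ x in cell L, P x * conj (φ x) :=
      integral_sub (i1.sub i2) i3
    have e3 : ∫ x in cell L, (φ x * conj (φ x) - φ x * conj (P x)) =
        (∫ x in cell L, φ x * conj (φ x)) - ∫ x in cell L, φ x * conj (P x) :=
      integral_sub i1 i2
    rw [e1, e2, e3]
    -- (1) `∫ |φ|² = L³ ∑ |c_n|²` (Parseval)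
    have h1 : ∫ x in cell L, φ x * conj (φ x) = (L : ℂ) ^ 3 * ((∑' n, ‖c n‖ ^ 2 : ℝ) : ℂ) := by
      have hP := hasSum_sq_cellFourierCoeff hL hφ
      rw [hc, hP.tsum_eq]
      have : ∫ x in cell L, φ x * conj (φ x) = ((∫ x in cell L, ‖φ x‖ ^ 2 : ℝ) : ℂ) := by
        rw [← integral_complex_ofReal]
        exact integral_congr_ae (Eventually.of_forall fun x => by simp only; rw [Complex.mul_conj, Complex.normSq_eq_norm_sq, Complex.ofReal_pow])
      rw [this, hL3, ← Complex.ofReal_mul]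
      congr 1
      field_simp
    -- (2) `∫ φ conj(P) = L³ ∑_B |c_n|²`
    have h2 : ∫ x in cell L, φ x * conj (P x) = (L : ℂ) ^ 3 * ∑ n ∈ B, ((‖c n‖ ^ 2 : ℝ) : ℂ) := by
      have : ∀ x, φ x * conj (P x) = ∑ n ∈ B, conj (c n) * (φ x * conj (cellWave L n x)) := by
        intro x; simp only [hP, map_sum, map_mul, Finset.mul_sum]; exact Finset.sum_congr rfl fun n _ => by ring
      simp only [this]
      rw [integral_finsetSum _ fun n _ => (hint (show Continuous fun x => φ x * conj (cellWave L n x) from hφ.mul (Complex.continuous_conj.comp' (continuous_cellWave L n)))).const_mul _,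
        Finset.mul_sum]
      refine Finset.sum_congr rfl fun n _ => ?_
      rw [integral_const_mul, hcoef, Complex.ofReal_pow, ← Complex.conj_mul']; ring
    -- (3) `∫ P conj(φ) = L³ ∑_B |c_n|²`
    have h3 : ∫ x in cell L, P x * conj (φ x) = (L : ℂ) ^ 3 * ∑ n ∈ B, ((‖c n‖ ^ 2 : ℝ) : ℂ) := by
      have : ∫ x in cell L, P x * conj (φ x) = conj (∫ x in cell L, φ x * conj (P x)) := by
        rw [← integral_conj]; exact integral_congr_ae (Eventually.of_forall fun x => by simp only [map_mul, Complex.conj_conj]; ring)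
      rw [this, h2, map_mul, map_sum]
      congr 1
      · rw [map_pow, Complex.conj_ofReal]
      · exact Finset.sum_congr rfl fun n _ => Complex.conj_ofReal _
    -- (4) `∫ |P|² = L³ ∑_B |c_n|²`
    have h4 : ∫ x in cell L, P x * conj (P x) = (L : ℂ) ^ 3 * ∑ n ∈ B, ((‖c n‖ ^ 2 : ℝ) : ℂ) := by
      have : ∀ x, P x * conj (P x) = ∑ n ∈ B, ∑ m ∈ B, c m * conj (c n) * (cellWave L m x * conj (cellWave L n x)) := by
        intro x
        simp only [hP, map_sum, Finset.sum_mul, Finset.mul_sum, map_mul]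
        exact Finset.sum_congr rfl fun n _ => Finset.sum_congr rfl fun m _ => by ring
      simp only [this]
      rw [integral_finsetSum _ fun n _ => integrable_finsetSum _ fun m _ =>
        (hint (show Continuous fun x => cellWave L m x * conj (cellWave L n x) from (continuous_cellWave L m).mul (Complex.continuous_conj.comp' (continuous_cellWave L n)))).const_mul _]
      rw [Finset.mul_sum]
      refine Finset.sum_congr rfl fun n hn => ?_
      rw [integral_finsetSum _ fun m _ => (hint (show Continuous fun x => cellWave L m x * conj (cellWave L n x) from (continuous_cellWave L m).mul (Complex.continuous_conj.comp' (continuous_cellWave L n)))).const_mul _]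
      simp only [integral_const_mul, horth, mul_ite, mul_zero, Finset.sum_ite_eq', if_pos hn]
      rw [Complex.ofReal_pow, ← Complex.conj_mul']; ring
    rw [h1, h2, h3, h4]
    ring
  rw [hL3] at hmain
  have hsum : ∑ n ∈ B, ((‖c n‖ ^ 2 : ℝ) : ℂ) = ((∑ n ∈ B, ‖c n‖ ^ 2 : ℝ) : ℂ) := by push_cast; rfl
  rw [hsum, ← Complex.ofReal_mul, ← Complex.ofReal_mul, ← Complex.ofReal_sub] at hmain
  have hre := Complex.ofReal_injective hmain
  rw [hre]
  ring

end Literature.MathematicalPhysics.QuantumManyBody.BoseGas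

end
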